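import Mathlib
import Summits.ValiantsHypothesis.ValiantsHypothesis.Theorems.KPlusLogSqLawTropicalBExpirationProperty

/-!
# Route «KPlusLogSqLaw», crux `TropicalB` (stmt-ValiantsHypothesis-19771) — RETURNS ARE ESCORTED ROW EXCURSIONS
# (the returns currency of `…TropicalBReturns` under the expiration property of `…TropicalBExpirationProperty`)

HONEST FRAMING.  Helper file (cell `pub-symmetroid`, seat val-sym-trop-p1 g22, 2026-08-29) `--supports` the crux
`Summit.ValiantsHypothesis.ValiantsHypothesis.Theses.KPlusLogSqLaw.TropicalB` (item `stmt-ValiantsHypothesis-19771`, registered stubs `stub_tropThin` /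
`stub_tropFat` of `Cruxes/TropicalB/Lines/birth.lean`).  Two corollaries of the expiration property (val-sym-trop-p5 g19, `Expiration.eqOn_of_between`)
phrased for single columns — the events that the runs/returns accounting of `…TropicalBReturns` (this seat, p669495) shows every long chain must spend.
STRUCTURE laws for dominant chains of ARBITRARY designs; nothing here bounds `TropicalB` and nothing bears on `WeakLifting`, DoorA26 / DoorA34,
`MatrixDescartes` (stmt-ValiantsHypothesis-18050) or VP ≠ VNP.

* `sameRow_between` — **NO CLASS-ONLY EXCURSION**: if three dominant terms at slopes `θ₁ < θ₂ < θ₃` give column `j` the same incidence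
  `(row, class)` at `θ₁` and `θ₃` and the same ROW at `θ₂`, then also the same class at `θ₂` (the singleton `{j}` is an invariant block).  So a column
  that RETURNS to an incidence it has left must leave the ROW in between (a return is a row excursion) — `row_excursion_of_return`.
* `escort_of_excursion` / `escort_of_return` — **ESCORT LAW**: if column `j` carries at `θ₂` an incidence different from the one at `θ₁`, the orbit
  of `j` under the quotient `σ₁⁻¹σ₂` contains a column NOT restored at `θ₃`; if moreover `j` itself is restored (a return), that column is another
  one — every return is escorted, at every intermediate time, by a non-restored column of the same exchange orbit.
* chain forms `chain_row_excursion_of_return`, `chain_escort_of_return` (indices `i < t < k` of a dominant chain at strictly increasing slopes).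
READING (located, seat memo DUAL-LANE-g22 §7–§8, not claimed): the counting-tight `(5,4)` chain of the tree returns 131 times in 56 terms; by the present
file each of these returns is a row excursion with escorts at all intermediate times.  [this seat; expiration is trop-p5 g19's, cyclewise monotonicity
conjb-2 g4 / trop-p4 g2]
-/

set_option linter.dupNamespace false
set_option autoImplicit false

namespace Summit.ValiantsHypothesis.ValiantsHypothesis.Theorems.KPlusLogSqLaw

open Summit.ValiantsHypothesis.ValiantsHypothesis.Theorems.MatrixDescartes.Negative
open Finset

namespace Returns

variable {m K : ℕ}

/-- the orbit of `j` under a permutation, as a finset, is invariant. [elementary] -/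
theorem sameCycle_filter_invariant (π : Equiv.Perm (Fin m)) (j : Fin m) :
    ∀ b, π b ∈ (univ.filter fun b => π.SameCycle j b) ↔ b ∈ (univ.filter fun b => π.SameCycle j b) := by
  intro b
  simp only [mem_filter, mem_univ, true_and]
  exact Equiv.Perm.sameCycle_apply_right

/-- **NO CLASS-ONLY EXCURSION.**  Same incidence of column `j` at `θ₁` and `θ₃`, same row at `θ₂` ⇒ same class at `θ₂`. [this seat, from
`Expiration.eqOn_of_between` with `T = {j}`] -/
theorem sameRow_between (d : Fin K → ℕ) (v ε : Fin m → Fin m → Fin K → ℤ) {θ₁ θ₂ θ₃ : ℤ} (h₁₂ : θ₁ < θ₂) (h₂₃ : θ₂ < θ₃)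
    {σ₁ σ₂ σ₃ : Equiv.Perm (Fin m)} {l₁ l₂ l₃ : Fin m → Fin K}
    (h₁ : IsDominant d v ε θ₁ (σ₁, l₁)) (h₂ : IsDominant d v ε θ₂ (σ₂, l₂)) (h₃ : IsDominant d v ε θ₃ (σ₃, l₃))
    (j : Fin m) (h₁₃ : σ₁ j = σ₃ j ∧ l₁ j = l₃ j) (hrow : σ₂ j = σ₁ j) : l₂ j = l₁ j := by
  classical
  have hT : ∀ b, (σ₁⁻¹ * σ₂) b ∈ ({j} : Finset (Fin m)) ↔ b ∈ ({j} : Finset (Fin m)) := by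
    intro b
    simp only [mem_singleton]
    have hfix : (σ₁⁻¹ * σ₂) j = j := by
      rw [Equiv.Perm.mul_apply, hrow]; simp
    constructor
    · intro h; exact (σ₁⁻¹ * σ₂).injective (h.trans hfix.symm)
    · intro h; rw [h]; exact hfix
  have := Expiration.eqOn_of_between d v ε h₁₂ h₂₃ h₁ h₂ h₃ {j} hT (fun b hb => by rw [mem_singleton.mp hb]; exact h₁₃) j
    (mem_singleton_self j)
  exact this.2

/-- **A RETURN IS A ROW EXCURSION**: same incidence of column `j` at `θ₁` and `θ₃`, a different incidence at `θ₂` ⇒ a different ROW at `θ₂`.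
[this seat] -/
theorem row_excursion_of_return (d : Fin K → ℕ) (v ε : Fin m → Fin m → Fin K → ℤ) {θ₁ θ₂ θ₃ : ℤ} (h₁₂ : θ₁ < θ₂) (h₂₃ : θ₂ < θ₃)
    {σ₁ σ₂ σ₃ : Equiv.Perm (Fin m)} {l₁ l₂ l₃ : Fin m → Fin K}
    (h₁ : IsDominant d v ε θ₁ (σ₁, l₁)) (h₂ : IsDominant d v ε θ₂ (σ₂, l₂)) (h₃ : IsDominant d v ε θ₃ (σ₃, l₃))
    (j : Fin m) (h₁₃ : σ₁ j = σ₃ j ∧ l₁ j = l₃ j) (hne : σ₂ j ≠ σ₁ j ∨ l₂ j ≠ l₁ j) : σ₂ j ≠ σ₁ j := by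
  intro hrow
  rcases hne with h | h
  · exact h hrow
  · exact h (sameRow_between d v ε h₁₂ h₂₃ h₁ h₂ h₃ j h₁₃ hrow)

/-- **ESCORT LAW (excursion form).**  If column `j` carries at `θ₂` an incidence different from the one at `θ₁`, then some column `b` in the
orbit of `j` under `σ₁⁻¹σ₂` is NOT restored at `θ₃` (its incidence at `θ₃` differs from the one at `θ₁`). [this seat, = `Expiration.not_restored` on
the orbit of `j`] -/
theorem escort_of_excursion (d : Fin K → ℕ) (v ε : Fin m → Fin m → Fin K → ℤ) {θ₁ θ₂ θ₃ : ℤ} (h₁₂ : θ₁ < θ₂) (h₂₃ : θ₂ < θ₃)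
    {σ₁ σ₂ σ₃ : Equiv.Perm (Fin m)} {l₁ l₂ l₃ : Fin m → Fin K}
    (h₁ : IsDominant d v ε θ₁ (σ₁, l₁)) (h₂ : IsDominant d v ε θ₂ (σ₂, l₂)) (h₃ : IsDominant d v ε θ₃ (σ₃, l₃))
    (j : Fin m) (hne : σ₂ j ≠ σ₁ j ∨ l₂ j ≠ l₁ j) :
    ∃ b, (σ₁⁻¹ * σ₂).SameCycle j b ∧ (σ₁ b ≠ σ₃ b ∨ l₁ b ≠ l₃ b) := by
  classical
  by_contra hcon
  push Not at hcon
  set T := univ.filter fun b => (σ₁⁻¹ * σ₂).SameCycle j b with hT_def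
  have hT := sameCycle_filter_invariant (σ₁⁻¹ * σ₂) j
  have h13T : ∀ b ∈ T, σ₁ b = σ₃ b ∧ l₁ b = l₃ b := by
    intro b hb
    have hb' : (σ₁⁻¹ * σ₂).SameCycle j b := (mem_filter.mp hb).2
    exact hcon b hb'
  have hjT : j ∈ T := mem_filter.mpr ⟨mem_univ _, Equiv.Perm.SameCycle.refl _ _⟩
  have e := Expiration.eqOn_of_between d v ε h₁₂ h₂₃ h₁ h₂ h₃ T hT h13T j hjT
  rcases hne with h | h
  · exact h e.1
  · exact h e.2

/-- **ESCORT LAW (return form).**  If column `j` RETURNS — same incidence at `θ₁` and `θ₃`, a different one at `θ₂` — then some OTHER column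
`b ≠ j` of the orbit of `j` under `σ₁⁻¹σ₂` is not restored at `θ₃`: every return is escorted by a non-restored column of the same exchange orbit, at
every intermediate time. [this seat] -/
theorem escort_of_return (d : Fin K → ℕ) (v ε : Fin m → Fin m → Fin K → ℤ) {θ₁ θ₂ θ₃ : ℤ} (h₁₂ : θ₁ < θ₂) (h₂₃ : θ₂ < θ₃)
    {σ₁ σ₂ σ₃ : Equiv.Perm (Fin m)} {l₁ l₂ l₃ : Fin m → Fin K}
    (h₁ : IsDominant d v ε θ₁ (σ₁, l₁)) (h₂ : IsDominant d v ε θ₂ (σ₂, l₂)) (h₃ : IsDominant d v ε θ₃ (σ₃, l₃))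
    (j : Fin m) (h₁₃ : σ₁ j = σ₃ j ∧ l₁ j = l₃ j) (hne : σ₂ j ≠ σ₁ j ∨ l₂ j ≠ l₁ j) :
    ∃ b, b ≠ j ∧ (σ₁⁻¹ * σ₂).SameCycle j b ∧ (σ₁ b ≠ σ₃ b ∨ l₁ b ≠ l₃ b) := by
  obtain ⟨b, hb, hnr⟩ := escort_of_excursion d v ε h₁₂ h₂₃ h₁ h₂ h₃ j hne
  refine ⟨b, ?_, hb, hnr⟩
  rintro rfl
  rcases hnr with h | h
  · exact h h₁₃.1
  · exact h h₁₃.2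

/-! ## Chain forms -/

/-- **chain form of the row-excursion law.** [this seat] -/
theorem chain_row_excursion_of_return (d : Fin K → ℕ) (v ε : Fin m → Fin m → Fin K → ℤ) {n : ℕ} {θ : Fin (n + 1) → ℤ}
    (hθ : StrictMono θ) {p : Fin (n + 1) → Equiv.Perm (Fin m) × (Fin m → Fin K)} (hdom : ∀ t, IsDominant d v ε (θ t) (p t))
    {i t k : Fin (n + 1)} (hit : i < t) (htk : t < k) (j : Fin m)
    (hik : (p i).1 j = (p k).1 j ∧ (p i).2 j = (p k).2 j) (hne : (p t).1 j ≠ (p i).1 j ∨ (p t).2 j ≠ (p i).2 j) :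
    (p t).1 j ≠ (p i).1 j :=
  row_excursion_of_return d v ε (hθ hit) (hθ htk) (hdom i) (hdom t) (hdom k) j hik hne

/-- **chain form of the escort law.** [this seat] -/
theorem chain_escort_of_return (d : Fin K → ℕ) (v ε : Fin m → Fin m → Fin K → ℤ) {n : ℕ} {θ : Fin (n + 1) → ℤ}
    (hθ : StrictMono θ) {p : Fin (n + 1) → Equiv.Perm (Fin m) × (Fin m → Fin K)} (hdom : ∀ t, IsDominant d v ε (θ t) (p t))
    {i t k : Fin (n + 1)} (hit : i < t) (htk : t < k) (j : Fin m)
    (hik : (p i).1 j = (p k).1 j ∧ (p i).2 j = (p k).2 j) (hne : (p t).1 j ≠ (p i).1 j ∨ (p t).2 j ≠ (p i).2 j) :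
    ∃ b, b ≠ j ∧ ((p i).1⁻¹ * (p t).1).SameCycle j b ∧ ((p i).1 b ≠ (p k).1 b ∨ (p i).2 b ≠ (p k).2 b) :=
  escort_of_return d v ε (hθ hit) (hθ htk) (hdom i) (hdom t) (hdom k) j hik hne

end Returns

end Summit.ValiantsHypothesis.ValiantsHypothesis.Theorems.KPlusLogSqLaw
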